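import Summits.QuantumFields.QCD.Theorems.HeatSlicedQuarksRobustYangMillsHandoverTransferOpEmbed

/-!
# Iterates of the scalar transfer operator on the embedded form core
(crux `HeatSlicedQuarks.RobustYangMillsHandover`, item stmt-QuantumFields-8892, line `pin-the-infimum`;
registered wave-2 sub-goal `transferOp_pow_embed` of the spectral infrastructure M2)

Smit (*Introduction to Quantum Fields on a Lattice*, §6.5 (6.87)) writes the transfer matrix of
lattice QCD with `r = 1` Wilson quarks as `T̂ = T̂_F^{1/2} T̂_U T̂_F^{1/2}`.  The lead realises it as
a scalar integral operator `T` on `L²(ν)`, `ν = sliceHaar S ⊗ count` on `SU(3)^{Edge 3 S} × J`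
(`J ≃ Finset (SliceFermiIdx Nf S)` an enumeration of the occupation basis of the quark Fock space),
with kernel `k((U,s),(U',t)) = K_β(U,U') · (R(U) R(U'))_{st}` (`R(U)` a continuous, Hermitian,
gauge-covariant square root of `T̂_F(U) = fermionSliceOp U mq`).  Core wave functions `Ψ` are
embedded as `f_Ψ(U, j) = (R(U) Ψ(U))_{e⁻¹ j}`, and the landed sub-goal `transferOp_apply_embed`
shows `T f_Ψ = f_{𝒮Ψ}` a.e. with the step
`(𝒮Ψ)(U) = ∫ K_β(U,U') • (T̂_F(U') Ψ(U')) dU'`, which is continuous and preserves the Gauss law.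

This file iterates that statement: for `Ψ` in the form core and every `n`,

* `𝒮^[n] Ψ` lies in the form core (induction, conjuncts 1–2 of `transferOp_apply_embed`);
* `Tⁿ f = f_{𝒮^[n] Ψ}` a.e. for every embedding `f` of `Ψ` (induction on `n`: `T^(n+1) = T * Tⁿ`,
  `𝒮^[n+1] Ψ = 𝒮 (𝒮^[n] Ψ)`, and conjunct 3 of `transferOp_apply_embed` applied to the continuous
  wave function `𝒮^[n] Ψ` and its embedding `Tⁿ f`).

References: J. Smit, *Introduction to Quantum Fields on a Lattice* (2023), §6.5 (6.87)
[Smit2023]; M. Lüscher, Commun. Math. Phys. 54 (1977) 283 [Luscher1977].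
Pure theorem file (no definitions).
-/

noncomputable section

namespace Summit.QuantumFields.QCD.Cruxes.RobustYangMillsHandover.PinTheInfimum

open MeasureTheory Matrix Literature.MathematicalPhysics.QuantumFieldTheory
  Literature.MathematicalPhysics.QuantumLattice
open Literature.Probability.LatticeModels (TorusSite)

/-- **Registered sub-goal `transferOp_pow_embed` (line `pin-the-infimum`): iterates of the scalar
transfer operator on the embedded form core.**  Let `R(U)` be a continuous, Hermitian,
gauge-covariant square root of `T̂_F(U)` (`R(U)² = fermionSliceOp U mq`), `e` an enumeration of the
Fock basis, and `T` any bounded operator on `L²(sliceHaar ⊗ count)` given a.e. by the kernel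
`k((U,s),(U',t)) = K_β(U,U') (R(U)R(U'))_{st}`.  With the step
`(𝒮Ψ)(U) = ∫ K_β(U,U') • T̂_F(U')Ψ(U') dU'`, for every `Ψ` in the form core and every `n : ℕ` the
iterate `𝒮^[n] Ψ` is again in the form core, and for every `f ∈ L²` with
`f(U,j) = (R(U)Ψ(U))_{e⁻¹j}` a.e. one has `(Tⁿ f)(U,j) = (R(U) (𝒮^[n]Ψ)(U))_{e⁻¹j}` a.e. —
the `n`-th power of Smit's `T̂ = T̂_F^{1/2} T̂_U T̂_F^{1/2}` acting on `T̂_F^{1/2}Ψ`.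
[cite: Smit2023, §6.5 (6.87)] -/
theorem transferOp_pow_embed : ∀ (Nf S : ℕ) [NeZero S] (β : ℝ) (mq : Fin Nf → ℝ)
    (J : Type) [Fintype J] [MeasurableSpace J] [MeasurableSingletonClass J]
    (e : Finset (SliceFermiIdx Nf S) ≃ J)
    (R : GaugeConfig 3 S (Matrix.specialUnitaryGroup (Fin 3) ℂ) →
      Matrix (Finset (SliceFermiIdx Nf S)) (Finset (SliceFermiIdx Nf S)) ℂ),
    Continuous R → (∀ U, (R U)ᴴ = R U) → (∀ U, R U * R U = fermionSliceOp U mq) →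
    (∀ (g : TorusSite 3 S → Matrix.specialUnitaryGroup (Fin 3) ℂ)
      (U : GaugeConfig 3 S (Matrix.specialUnitaryGroup (Fin 3) ℂ)),
      R (gaugeTransform g U) = fockGaugeAct g * R U * (fockGaugeAct g)ᴴ) →
    ∀ T : Lp ℂ 2 ((sliceHaar S).prod (Measure.count : Measure J)) →L[ℂ]
        Lp ℂ 2 ((sliceHaar S).prod (Measure.count : Measure J)),
      (∀ φ : Lp ℂ 2 ((sliceHaar S).prod (Measure.count : Measure J)),
        (T φ : GaugeConfig 3 S (Matrix.specialUnitaryGroup (Fin 3) ℂ) × J → ℂ)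
          =ᵐ[(sliceHaar S).prod (Measure.count : Measure J)] fun p =>
            ∫ q, (gaugeSliceKernel β p.1 q.1 : ℂ) * (R p.1 * R q.1) (e.symm p.2) (e.symm q.2) * φ q
              ∂((sliceHaar S).prod (Measure.count : Measure J))) →
      ∀ Ψ ∈ transferCore Nf S, ∀ n : ℕ,
        (fun (Φ : SliceWave Nf S) (U : GaugeConfig 3 S (Matrix.specialUnitaryGroup (Fin 3) ℂ)) =>
            ∫ U', (gaugeSliceKernel β U U' : ℂ) • (fermionSliceOp U' mq *ᵥ Φ U') ∂(sliceHaar S))^[n] Ψ ∈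
            transferCore Nf S ∧
          ∀ f : Lp ℂ 2 ((sliceHaar S).prod (Measure.count : Measure J)),
            ((f : GaugeConfig 3 S (Matrix.specialUnitaryGroup (Fin 3) ℂ) × J → ℂ)
              =ᵐ[(sliceHaar S).prod (Measure.count : Measure J)] fun p => (R p.1 *ᵥ Ψ p.1) (e.symm p.2)) →
            (((T ^ n) f : Lp ℂ 2 ((sliceHaar S).prod (Measure.count : Measure J))) :
                GaugeConfig 3 S (Matrix.specialUnitaryGroup (Fin 3) ℂ) × J → ℂ)
              =ᵐ[(sliceHaar S).prod (Measure.count : Measure J)] fun p =>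
                (R p.1 *ᵥ ((fun (Φ : SliceWave Nf S) (U : GaugeConfig 3 S (Matrix.specialUnitaryGroup (Fin 3) ℂ)) =>
                    ∫ U', (gaugeSliceKernel β U U' : ℂ) • (fermionSliceOp U' mq *ᵥ Φ U') ∂(sliceHaar S))^[n] Ψ)
                  p.1) (e.symm p.2) := by
  intro Nf S _ β mq J _ _ _ e R hR hRH hRR hRg T hT Ψ hΨ n
  induction n with
  | zero =>
      refine ⟨?_, fun f hf => ?_⟩
      · simpa only [Function.iterate_zero, id_eq] using hΨ
      · simpa only [pow_zero, one_apply_eq_self, Function.iterate_zero, id_eq] using hf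
  | succ n ih =>
      obtain ⟨hn, hstep⟩ := ih
      -- the landed one-step statement, applied to the continuous wave function `𝒮^[n] Ψ`
      have key := transferOp_apply_embed Nf S β mq J e R hR hRH hRR hRg _ hn.1
      refine ⟨?_, fun f hf => ?_⟩
      · rw [Function.iterate_succ_apply']
        exact ⟨key.1, key.2.1 hn.2⟩
      · rw [pow_succ', mul_apply_eq_comp, Function.iterate_succ_apply']
        exact key.2.2 ((T ^ n) f) (hstep f hf) T hT

end Summit.QuantumFields.QCD.Cruxes.RobustYangMillsHandover.PinTheInfimum

end
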